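import Literature.NumberTheory.EllipticCurves.TateCurve.NumberFieldUniformizationTwisted
import Literature.NumberTheory.EllipticCurves.TateCurve.MultiplicativeTwistUnramifiedProofs
import Literature.NumberTheory.EllipticCurves.TateCurve.TorsionGaloisModule
import Literature.NumberTheory.EllipticCurves.MultiplicativeUnramifiedTorsionProofs
import HarnessLib

/-!
# Multiplicative reduction with the Tate parameter an `n`-th power in `K_v`: an inertia element
# fixing `μ_n` fixes the `n`-torsion (Silverman, *ATAEC* V §3 / proof of Prop. V.6.1:
# `K_v(E_q[n]) = K_v(ζ_n, q^{1/n})`), for every `n` — in particular at `v ∣ n`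

`Proofs` file (theorems only: no definition, no named fact) in topic
`NumberTheory/EllipticCurves/TateCurve`. Sibling of `MultiplicativeUnramifiedTorsionProofs`
(`v ∤ p`, `p ∣ ord_v Δ_min` ⇒ the inertia group fixes `E[p]`, proved there WITHOUT the Tate curve)
and of `MultiplicativeTwistUnramifiedProofs` (the inertia group fixes `√γ`, `γ = −c₄/c₆`). Source:
J. H. Silverman, *Advanced Topics in the Arithmetic of Elliptic Curves*, GTM 151 (1994), Ch. V:
Thm. V.3.1 (c),(d) (PDF pp. 395–399: `E_q[n] = ⟨ζ_n, q^{1/n}⟩ q^ℤ/q^ℤ`, so `K(E_q[n]) = K(ζ_n, q^{1/n})`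
— the tree's `TateCurve.mem_ker_galoisRepTorsion_tateCurve_iff`, abc-iut-L2-t5), Lemma V.5.2 (c),
Thm. V.5.3, Cor. V.5.4 (PDF pp. 406–410: a curve with multiplicative reduction at `v` is the twist of
`E_q` by the UNRAMIFIED character `χ` of `K_v(√γ)/K_v` — the tree's `TateCurve.smul_eq_sign_smul`,
`isomorphic_tateCurve_of_one_lt_norm_j_holds`, `toAlgEquiv_eq_of_mem_inertia_of_sq_eq_gamma`);
J.-P. Serre, *Propriétés galoisiennes des points d'ordre fini des courbes elliptiques*, Invent. Math.
**15** (1972) §1.12 («courbes de Tate»: the image of inertia in `Aut E[p]` at a multiplicative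
`v ∣ p` is `(χ *; 0 1)`, the `*` being the Kummer cocycle of `q`).

THE POINT. If the Tate parameter `q ∈ K_v` of `E` at a multiplicative place `v` is an `n`-TH POWER
IN `K_v` (`q = y^n`), the Kummer cocycle of `q` vanishes identically, so an element `τ` of the inertia
group acts on `E[n]` through its action on `μ_n` alone (and the unramified sign `χ(τ) = 1`): **if `τ`
fixes the `n`-th roots of unity, `τ` fixes every `n`-torsion point.** No hypothesis `v ∤ n`: at `v ∣ p`,
`n = p`, this is the statement that `ρ̄_{E,p}` restricted to the inertia group of `K_v` factors through
`Gal(K_v^{nr}(ζ_p)/K_v^{nr})` (order `∣ p − 1`, NO wild part) as soon as `q ∈ (K_v^×)^p` — the «SPLIT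
packet» case of the abc-iut R-W window table's wild local type (GAP G-Wnum2-1 (i); W-num-2's
W2-POLES with `u^{p−1} ≡ 1 (mod p²)`), where the generic factor `p` of `e(K_u/ℚ_p)` is ABSENT.

* `WeierstrassCurve.smul_eq_of_mem_inertia_of_pow_eq_tateParameter` — LOCAL form: `W/K` elliptic over
  a number field with multiplicative reduction at `v`, `q ∈ K_v` with `q ≠ 0`, `|q|_v < 1`,
  `j(E_q) = j(W)` (the Tate parameter) and `y ∈ K_v` with `y^n = q` (`0 < n`); then every `τ` in the
  inertia group `I_𝔐 ≤ Γ_{K_v}` fixing all `ζ ∈ K̄_v` with `ζ^n = 1` fixes every `P ∈ E(K̄_v)` with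
  `nP = O`;
* `WeierstrassCurve.smul_eq_of_mem_inertia_of_pow_eq_tateParameter_of_nsmul_eq_zero` /
  `WeierstrassCurve.smul_geomTorsion_eq_of_mem_inertia_of_pow_eq_tateParameter` — GLOBAL form for the
  inertia group `I_𝔓 ≤ Gal(K̄/K)` of a prime `𝔓 ∣ v` of `\bar ℤ_K` acting on `E(K̄)[n]`
  (lift `τ` to the local inertia group along an embedding `K̄ → K̄_v` cutting out `𝔓`,
  Neukirch *ANT* II (9.6), the glue of `smul_eq_of_mem_inertia_of_hasMultiplicativeReductionAt_of_dvd_of_nsmul_eq_zero`);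
* `WeierstrassCurve.galoisRepTorsion_eq_one_of_mem_inertia_of_pow_eq_tateParameter` — the same read
  as `ρ̄_{E,n}(τ) = 1`.

Proof (local). By V.5.3 (a) there is an isomorphism `C : W ⊗ K̄_v ⥲ E_{q'} ⊗ K̄_v` with `q'` the Tate
parameter, `q' = q` by uniqueness (Lemma V.5.1); on points `τ(C P) = χ(τ) C(τ P)` (Lemma V.5.2 (c))
with `χ(τ) = 1` because the inertia group fixes `t = √γ` (`K_v(√γ)/K_v` unramified at a multiplicative
place); and `τ` fixes `E_q[n](K̄_v)` because it fixes `ζ_n` (hypothesis) and the root `Q = y` of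
`X^n − q`, which lies in `K_v` (Thm. V.3.1 (c),(d)). Deliberate dot-notation extensions of Mathlib's
`WeierstrassCurve` namespace, as in the sibling files; universe `0` (the universe of the tree's
normed-field structure on `v.adicCompletion K` used by the Tate-curve stack); `set_option maxHeartbeats`
is raised for the local theorem (instance unification on `Γ_{K_v}` when the twisted-equivariance lemma is
specialised, as in `Greenberg1999/ControlLocalKernelsLayerMultiplicativeProofs`).

## References
* [SilvermanATAEC1994] J. H. Silverman, *Advanced Topics in the Arithmetic of Elliptic Curves*,
  GTM 151 (1994), Thm. V.3.1 (c),(d), Lemma V.5.1, Lemma V.5.2 (c), Thm. V.5.3, Cor. V.5.4,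
  proof of Prop. V.6.1 (PDF pp. 395–411).
* [SerreInventiones1972] J.-P. Serre, Invent. Math. 15 (1972), §1.12.
* [NeukirchANT1999] J. Neukirch, *Algebraic Number Theory* (1999), Ch. II §9 Prop. (9.6).
-/

noncomputable section

open scoped Classical
open NumberField IsDedekindDomain Field

namespace WeierstrassCurve

open Literature.NumberTheory.EllipticCurves Literature.NumberTheory.EllipticCurves.TateCurve
  Literature.NumberTheory.GaloisRepresentations SteinWuthrich2013

variable {K : Type} [Field K] [NumberField K] (W : WeierstrassCurve K) {v : HeightOneSpectrum (𝓞 K)}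

set_option maxHeartbeats 1600000 in
/-- **Tate parameter an `n`-th power ⇒ an inertia element fixing `μ_n` fixes `E[n]`, LOCAL form.**
Let `W/K` be an elliptic curve over a number field with multiplicative reduction at the finite place
`v`, `q ∈ K_v` the Tate parameter (`q ≠ 0`, `|q|_v < 1`, `j(E_q) = j(W)`) and suppose `q = y^n` with
`y ∈ K_v`, `0 < n`. Then every `τ` in the inertia group `I_𝔐 ≤ Γ_{K_v}` that fixes every `ζ ∈ K̄_v`
with `ζ^n = 1` fixes every `P ∈ E(K̄_v)` with `nP = O`: `W ⊗ K̄_v ≅ E_q ⊗ K̄_v` (V.5.3 (a)) with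
`τ(C P) = χ(τ)·C(τP)` (V.5.2 (c)) and `χ(τ) = 1` on inertia (`K_v(√γ)/K_v` unramified), while
`K_v(E_q[n]) = K_v(ζ_n, q^{1/n}) = K_v(ζ_n)` (V.3.1 (c),(d)). No hypothesis `v ∤ n`.
[cite: SilvermanATAEC1994, Thm. V.3.1 (c),(d), Lemma V.5.2 (c), Thm. V.5.3 (PDF pp. 395–410)]
[cite: SerreInventiones1972, §1.12] -/
theorem smul_eq_of_mem_inertia_of_pow_eq_tateParameter [W.IsElliptic]
    (hmult : W.HasMultiplicativeReductionAt v) {n : ℕ} (hn : 0 < n)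
    {q y : v.adicCompletion K} (hq0 : q ≠ 0) (hq : ‖q‖ < 1)
    (hqj : tateJ q = (W.baseChange (v.adicCompletion K)).j) (hy : y ^ n = q)
    {𝔐 : Ideal v.localAbsIntegers} (h𝔐 : 𝔐 ∈ v.localPrimesAbove)
    {τ : absoluteGaloisGroup (v.adicCompletion K)}
    (hτ : τ ∈ 𝔐.inertia (absoluteGaloisGroup (v.adicCompletion K)))
    (hζ : ∀ ζ : AlgebraicClosure (v.adicCompletion K), ζ ^ n = 1 → τ • ζ = ζ)
    (P : localPoints W (v.adicCompletion K)) (hP : n • P = 0) : τ • P = P := by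
  letI := Literature.NumberTheory.GaloisRepresentations.Ultrametric.AdicCompletion.nontriviallyNormedField K v
  haveI := charZero_adicCompletion' K v
  haveI : CharZero (AlgebraicClosure (v.adicCompletion K)) :=
    charZero_of_injective_algebraMap
      (algebraMap (v.adicCompletion K) (AlgebraicClosure (v.adicCompletion K))).injective
  -- `|j|_v > 1`, `c₄ c₆ ≠ 0`
  have hj := one_lt_norm_j_baseChange_of_hasMultiplicativeReductionAt W v hmult
  obtain ⟨hc₄, hc₆⟩ := c₄_ne_zero_and_c₆_ne_zero_of_hasMultiplicativeReductionAt W v hmult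
  -- V.5.3 (a): the Tate parameter `q'` and `C : W ⊗ K̄_v ⥲ E_{q'} ⊗ K̄_v`; `q' = q` (Lemma V.5.1)
  obtain ⟨q', hq0', hq', hqj', C, hC⟩ :=
    isomorphic_tateCurve_of_one_lt_norm_j_holds (W.baseChange (v.adicCompletion K)) hj
  have hqq : q' = q := tateParameter_unique hq0' hq' hqj' hq0 hq hqj
  subst hqq
  obtain ⟨hEc₄, hEc₆⟩ := tateCurve_c₄_ne_zero_and_c₆_ne_zero W v hq0' hq' hqj' hj
  -- a square root `t` of `γ(W) = −c₄/c₆`, fixed by the inertia group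
  obtain ⟨t, ht⟩ := IsAlgClosed.exists_pow_nat_eq
    (algebraMap (v.adicCompletion K) (AlgebraicClosure (v.adicCompletion K))
      (algebraMap K (v.adicCompletion K) (-(W.c₄ / W.c₆)))) two_pos
  have hτt : absoluteGaloisGroup.toAlgEquiv (v.adicCompletion K) τ t = t :=
    toAlgEquiv_eq_of_mem_inertia_of_sq_eq_gamma W hmult h𝔐 ht hτ
  -- the isomorphism of point groups `e = C` and its twisted equivariance (V.5.2 (c))
  obtain ⟨e, he⟩ : ∃ e : localPoints W (v.adicCompletion K) ≃+ geomPoints (tateCurve q'),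
      ∀ P, e P = Affine.Point.congrEquiv hC (VariableChange.pointEquiv _ C
        (Affine.Point.congrEquiv (W.baseChange_baseChange_adicCompletion v).symm P)) :=
    ⟨(Affine.Point.congrEquiv (W.baseChange_baseChange_adicCompletion v).symm).trans
      ((VariableChange.pointEquiv ((W.baseChange (v.adicCompletion K)).baseChange
        (AlgebraicClosure (v.adicCompletion K))) C).trans (Affine.Point.congrEquiv hC)),
      fun _ ↦ rfl⟩
  have hsign := smul_eq_sign_smul W v hc₄ hc₆ hq' hEc₄ hEc₆ C hC ht e he τ P
  rw [if_pos hτt, one_zsmul] at hsign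
  -- `τ` acts trivially on `E_q[n](K̄_v)`: it fixes `ζ_n` and the root `y ∈ K_v` of `X^n − q`
  have hker : τ ∈ (galoisRepTorsion (tateCurve q') (n : ℤ)).ker := by
    rw [mem_ker_galoisRepTorsion_tateCurve_iff q' hq0' hq' hn]
    intro x hx
    rcases hx with hx | hx
    · exact hζ x hx
    · have hy0 : y ≠ 0 := by
        rintro rfl
        rw [zero_pow hn.ne'] at hy
        exact hq0' hy.symm
      set Y : AlgebraicClosure (v.adicCompletion K) :=
        algebraMap (v.adicCompletion K) (AlgebraicClosure (v.adicCompletion K)) y with hYdef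
      have hY0 : Y ≠ 0 := (map_ne_zero _).mpr hy0
      have hxY : (x * Y⁻¹) ^ n = 1 := by
        rw [mul_pow, inv_pow, hx, ← hy, map_pow, mul_inv_cancel₀ (pow_ne_zero _ hY0)]
      have h1 : τ • (x * Y⁻¹) = x * Y⁻¹ := hζ _ hxY
      have hτY : τ • Y = Y := by
        rw [absoluteGaloisGroup.smul_def]
        exact AlgEquiv.commutes _ y
      have hxe : x = (x * Y⁻¹) * Y := by rw [inv_mul_cancel_right₀ hY0]
      rw [absoluteGaloisGroup.smul_def] at h1 hτY ⊢
      rw [hxe, map_mul, h1, hτY]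
  -- hence `τ • e P = e P`
  have heP : (n : ℤ) • e P = 0 := by
    rw [natCast_zsmul, ← map_nsmul, hP, map_zero]
  have hfix : τ • e P = e P := by
    have hmem : τ ∈ ((galoisRepTorsion (tateCurve q') (n : ℤ)).ker : Set _) := hker
    rw [coe_ker_galoisRepTorsion] at hmem
    have h := Set.mem_iInter.1 hmem ⟨e P, (Submodule.mem_torsionBy_iff (n : ℤ) (e P)).mpr heP⟩
    exact MulAction.mem_stabilizer_iff.1 h
  -- conclude: `e (τ • P) = τ • e P = e P`
  exact e.injective (hsign.symm.trans hfix)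

open scoped Pointwise in
/-- **Tate parameter an `n`-th power ⇒ an inertia element fixing `μ_n` fixes `E[n]`, GLOBAL form.**
`W/K` elliptic over a number field with multiplicative reduction at `v`, Tate parameter `q = y^n ∈ K_v`
(`y ∈ K_v`, `0 < n`), `𝔓` a prime of `\bar ℤ_K` above `v`, `τ ∈ I_𝔓 ≤ Gal(K̄/K)` fixing every
`ζ ∈ K̄` with `ζ^n = 1`. Then `τ` fixes every `P ∈ E(K̄)` with `nP = O`. From the local form by
lifting `τ` to the local inertia group along an embedding `K̄ → K̄_v` cutting out `𝔓` (Neukirch *ANT*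
II (9.6), `exists_mem_inertia_apply_eq_holds`); the `n`-th roots of unity of `K̄_v` are the images of
those of `K̄`. [cite: SilvermanATAEC1994, Thm. V.3.1 (c),(d), Lemma V.5.2 (c), Thm. V.5.3 (PDF pp. 395–410)]
[cite: NeukirchANT1999, Ch. II §9 Prop. (9.6)] -/
theorem smul_eq_of_mem_inertia_of_pow_eq_tateParameter_of_nsmul_eq_zero [W.IsElliptic]
    (hmult : W.HasMultiplicativeReductionAt v) {n : ℕ} (hn : 0 < n)
    {q y : v.adicCompletion K} (hq0 : q ≠ 0) (hq : ‖q‖ < 1)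
    (hqj : tateJ q = (W.baseChange (v.adicCompletion K)).j) (hy : y ^ n = q)
    {𝔓 : Ideal (absIntegers (𝓞 K) K)} (h𝔓 : 𝔓 ∈ v.primesAbove)
    {τ : absoluteGaloisGroup K} (hτ : τ ∈ 𝔓.inertia (absoluteGaloisGroup K))
    (hζ : ∀ ζ : AlgebraicClosure K, ζ ^ n = 1 → τ • ζ = ζ)
    {P : geomPoints W} (hP : n • P = 0) : τ • P = P := by
  haveI : NeZero n := ⟨hn.ne'⟩
  haveI : CharZero (AlgebraicClosure K) :=
    charZero_of_injective_algebraMap (algebraMap K (AlgebraicClosure K)).injective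
  obtain ⟨𝔐, h𝔐⟩ := v.localPrimesAbove_nonempty
  -- arrange `𝔓 = 𝔓_{ι,𝔐}` for an embedding `ι : K̄ → K̄_v`
  obtain ⟨g, hg⟩ := HeightOneSpectrum.exists_smul_eq_of_mem_primesAbove_holds
    (HeightOneSpectrum.primeBelow_mem_primesAbove
      (ι := closureEmb (K := K) (v.adicCompletion K)) h𝔐) h𝔓
  set ι : AlgebraicClosure K →ₐ[K] AlgebraicClosure (v.adicCompletion K) :=
    (closureEmb (K := K) (v.adicCompletion K)).comp
      ((show AlgebraicClosure K ≃ₐ[K] AlgebraicClosure K from g⁻¹) :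
        AlgebraicClosure K →ₐ[K] AlgebraicClosure K) with hι
  have h1 : 𝔓 = v.primeBelow ι 𝔐 := by
    rw [hι, HeightOneSpectrum.primeBelow_comp, ← hg]
    exact congrArg (· • _) (inv_inv g).symm
  rw [h1] at hτ
  -- lift `τ ∈ I_𝔓` to the local inertia group `I_𝔐 ≤ Γ_{K_v}`
  obtain ⟨σ, hσI, hσ⟩ :=
    IsDedekindDomain.HeightOneSpectrum.exists_mem_inertia_apply_eq_holds v ι h𝔐 hτ
  have hres : resGalOfEmb ι σ = τ := resGalOfEmb_eq_of_apply_eq ι hσ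
  -- `σ` fixes the `n`-th roots of unity of `K̄_v` (images of those of `K̄`)
  have hσζ : ∀ ζ : AlgebraicClosure (v.adicCompletion K), ζ ^ n = 1 → σ • ζ = ζ := by
    obtain ⟨μ, hμ⟩ := HasEnoughRootsOfUnity.exists_primitiveRoot (AlgebraicClosure K) n
    have hιμ : IsPrimitiveRoot (ι μ) n := hμ.map_of_injective ι.injective
    intro ζ hζn
    obtain ⟨i, -, rfl⟩ := hιμ.eq_pow_of_pow_eq_one hζn
    have hμi : (μ ^ i) ^ n = 1 := by rw [← pow_mul, mul_comm, pow_mul, hμ.pow_eq_one, one_pow]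
    rw [← map_pow, ← hσ, hζ _ hμi]
  have hequiv : pointsMapOfEmb W ι (τ • P) = σ • pointsMapOfEmb W ι P := by
    rw [← hres]
    exact pointsMapOfEmb_smul W ι σ P
  have hfix : σ • pointsMapOfEmb W ι P = pointsMapOfEmb W ι P :=
    W.smul_eq_of_mem_inertia_of_pow_eq_tateParameter hmult hn hq0 hq hqj hy h𝔐 hσI hσζ
      (pointsMapOfEmb W ι P) (by rw [← map_nsmul, hP, map_zero])
  exact pointsMapOfEmb_injective W ι (hequiv.trans hfix)

/-- The same on the `Γ_K`-module `E[n] = geomTorsion W n`: an inertia element at a multiplicative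
place `v` fixing `μ_n` acts trivially on the `n`-torsion when the Tate parameter is an `n`-th power in
`K_v`. [cite: SilvermanATAEC1994, Thm. V.3.1 (c),(d), Thm. V.5.3 (PDF pp. 395–410)] -/
theorem smul_geomTorsion_eq_of_mem_inertia_of_pow_eq_tateParameter [W.IsElliptic]
    (hmult : W.HasMultiplicativeReductionAt v) {n : ℕ} (hn : 0 < n)
    {q y : v.adicCompletion K} (hq0 : q ≠ 0) (hq : ‖q‖ < 1)
    (hqj : tateJ q = (W.baseChange (v.adicCompletion K)).j) (hy : y ^ n = q)
    {𝔓 : Ideal (absIntegers (𝓞 K) K)} (h𝔓 : 𝔓 ∈ v.primesAbove)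
    {τ : absoluteGaloisGroup K} (hτ : τ ∈ 𝔓.inertia (absoluteGaloisGroup K))
    (hζ : ∀ ζ : AlgebraicClosure K, ζ ^ n = 1 → τ • ζ = ζ)
    (P : geomTorsion W (n : ℤ)) : τ • P = P :=
  Subtype.ext <| by
    rw [AddSubgroup.torsionBy.coe_smul]
    refine W.smul_eq_of_mem_inertia_of_pow_eq_tateParameter_of_nsmul_eq_zero hmult hn hq0 hq hqj
      hy h𝔓 hτ hζ ?_
    rw [← natCast_zsmul]
    exact (Submodule.mem_torsionBy_iff (n : ℤ) P.1).mp P.2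

/-- **`ρ̄_{E,n}(τ) = 1`** for an inertia element `τ ∈ I_𝔓` (`𝔓 ∣ v`, `v` multiplicative for `E`)
fixing `μ_n`, when the Tate parameter at `v` is an `n`-th power in `K_v` — the reading of
`smul_geomTorsion_eq_of_mem_inertia_of_pow_eq_tateParameter` on the mod-`n` representation. At `v ∣ p`,
`n = p`: NO WILD inertia acts on `E[p]` (Serre 1972 §1.12 with trivial Kummer class).
[cite: SilvermanATAEC1994, Thm. V.3.1 (c),(d), Thm. V.5.3 (PDF pp. 395–410)] [cite: SerreInventiones1972, §1.12] -/
theorem galoisRepTorsion_eq_one_of_mem_inertia_of_pow_eq_tateParameter [W.IsElliptic]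
    (hmult : W.HasMultiplicativeReductionAt v) {n : ℕ} (hn : 0 < n)
    {q y : v.adicCompletion K} (hq0 : q ≠ 0) (hq : ‖q‖ < 1)
    (hqj : tateJ q = (W.baseChange (v.adicCompletion K)).j) (hy : y ^ n = q)
    {𝔓 : Ideal (absIntegers (𝓞 K) K)} (h𝔓 : 𝔓 ∈ v.primesAbove)
    {τ : absoluteGaloisGroup K} (hτ : τ ∈ 𝔓.inertia (absoluteGaloisGroup K))
    (hζ : ∀ ζ : AlgebraicClosure K, ζ ^ n = 1 → τ • ζ = ζ) :
    W.galoisRepTorsion (n : ℤ) τ = 1 := by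
  refine Multiplicative.toAdd.injective (AddEquiv.ext fun P ↦ ?_)
  rw [galoisRepTorsion_apply]
  exact W.smul_geomTorsion_eq_of_mem_inertia_of_pow_eq_tateParameter hmult hn hq0 hq hqj hy h𝔓 hτ
    hζ P

end WeierstrassCurve

end
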